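import Mathlib
import HarnessLib
import Summits.Ventures.LatticeQCDFlow.Exactness.GaussianBlocks

/-!
# The law of the SU(2)-pair kick: its orbit law is the uniform law of the pair sub-sphere; polar factorisation of the Gaussian pair block

HONEST FRAMING: exact (Metropolis-corrected) sampling algorithms for lattice gauge theory;
figures of merit are autocorrelation/cost numbers at stated couplings and volumes; no
continuum-physics claim.

Venture `LatticeQCDFlow` (cell pub-lqcd), topic `Exactness`, FANOUT row 9 (eng-latcore, the
engine `latflow.core`; `update_link` in `csrc/latcore_template.c` runs one Cabibbo–Marinari
heat-bath hit per coordinate pair).  NEW WORK of the cell over Mathlib and row 9's earlier files;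
nothing is cited as a fact.  Part of the proof that the SU(N ≥ 3) Cabibbo–Marinari heat bath is
uniformly ergodic (the convolution of the SU(2)-pair Haar measures dominates Haar on `SU(N)`).

## What is proved (`n` a finite nonempty index type, `E n = ℝ^{n ⊕ n} ≅ ℂ^n`, `S n` its unit sphere)

* §1 **`pairLaw a b`** — the image of Haar(SU(2)) in the pair subgroup `(a, b)` (the law of the
  engine's subgroup kick); carried by `coordSubgroup {a, b}` (`ae_pairLaw_mem`), right-invariant
  under the pair subgroup (`pairLaw_map_mul_right`), transitive on the pair sub-sphere
  (`exists_pairHom_orbMap_eq`, `pairLaw_trans`); **`pairLaw_map_orbMap`** — its orbit law is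
  `subLaw {a, b}`; `map_act_eq_map_orbMap` (orbit laws from any point of the sub-sphere);
  **`eq_smul_subLaw_of_invariant`** — UNIQUENESS: an invariant finite measure carried by the
  sub-sphere is a multiple of `subLaw s`.
* §2 `radLaw s` (law of `‖p_s G‖`); `norm_projE_rotC`; **`stdGaussian_map_dir_norm_pair`** — under
  the standard Gaussian the direction and the length of the pair block are INDEPENDENT, the
  direction having law `subLaw {a, b}`.

NOT CLAIMED: the corresponding statements for blocks of more than two coordinates (they need the Haar measure of the coordinate subgroup; later file).
-/

namespace Summit.Ventures.LatticeQCDFlow.Exactness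

open Matrix MeasureTheory WithLp Metric Complex ProbabilityTheory Measure Set
open scoped ENNReal

variable {n : Type*} [Fintype n] [DecidableEq n]

/-! ## §1 The SU(2)-pair law; orbit laws from any point of the sub-sphere; uniqueness -/

section PairLaw

variable [Nonempty n]

/-- Abbreviation: the Haar probability of `SU(2)`. -/
noncomputable abbrev haarSU2 : Measure (Matrix.specialUnitaryGroup (Fin 2) ℂ) :=
  Literature.MathematicalPhysics.QuantumFieldTheory.haarProbability (Matrix.specialUnitaryGroup (Fin 2) ℂ)

/-- **The pair law**: the image of Haar(SU(2)) in the SU(2) subgroup of the coordinate pair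
`(a, b)` — the law of the engine's subgroup kick. -/
noncomputable def pairLaw (a b : n) (hab : a ≠ b) : Measure (Matrix.specialUnitaryGroup n ℂ) :=
  haarSU2.map (pairHom a b hab)

/-- It is a probability measure. -/
instance isProbabilityMeasure_pairLaw (a b : n) (hab : a ≠ b) : IsProbabilityMeasure (pairLaw a b hab) :=
  Measure.isProbabilityMeasure_map (measurable_pairHom a b hab).aemeasurable

omit [Nonempty n] in
/-- It is carried by the coordinate subgroup of `{a, b}`. -/
theorem ae_pairLaw_mem (a b : n) (hab : a ≠ b) :
    ∀ᵐ g ∂(pairLaw a b hab), g ∈ coordSubgroup ({a, b} : Finset n) := by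
  exact (ae_map_iff (measurable_pairHom a b hab).aemeasurable (isClosed_coordSubgroup _).measurableSet).2
    (ae_of_all _ fun A => pairHom_mem_coordSubgroup a b hab A)

omit [Nonempty n] in
/-- It is right-invariant under the pair subgroup. -/
theorem pairLaw_map_mul_right (a b : n) (hab : a ≠ b) (A : Matrix.specialUnitaryGroup (Fin 2) ℂ) :
    (pairLaw a b hab).map (fun g => g * pairHom a b hab A) = pairLaw a b hab := by
  rw [pairLaw, Measure.map_map (measurable_mul_const _) (measurable_pairHom a b hab)]
  have h : (fun g => g * pairHom a b hab A) ∘ (pairHom a b hab) = (pairHom a b hab) ∘ (fun h => h * A) := by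
    funext h; simp
  rw [h, ← Measure.map_map (measurable_pairHom a b hab) (measurable_mul_const A), map_mul_right_eq_self]

omit [Nonempty n] in
/-- The pair subgroup reaches every point of the sub-sphere of `{a, b}` from `e_a`. -/
theorem exists_pairHom_orbMap_eq (a b : n) (hab : a ≠ b) (z : S n)
    (hz : ∀ c ∉ ({a, b} : Finset n), cplx (z : E n) c = 0) :
    ∃ A : Matrix.specialUnitaryGroup (Fin 2) ℂ, orbMap a (pairHom a b hab A) = z := by
  have hn : Complex.normSq (cplx (z : E n) a) + Complex.normSq (cplx (z : E n) b) = 1 := by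
    have h1 := sum_norm_sq_cplx z
    rw [← Finset.sum_subset (Finset.subset_univ ({a, b} : Finset n))] at h1
    · rw [Finset.sum_pair hab, Complex.sq_norm, Complex.sq_norm] at h1; exact h1
    · intro c _ hc; simp [hz c hc]
  refine ⟨su2OfUnit _ _ hn, Subtype.ext (cplx_injective ?_)⟩
  rw [cplx_orbMap, ← mulVec_single_one, pairHom_mulVec_single, su2OfUnit_apply_00, su2OfUnit_apply_10]
  funext x
  by_cases hxa : x = a
  · subst hxa; simp [hab]
  · by_cases hxb : x = b
    · subst hxb; simp [hxa]
    · have hx : x ∉ ({a, b} : Finset n) := by simp [hxa, hxb]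
      simp [hxa, hxb, hz x hx]

omit [Nonempty n] in
/-- The transitivity-with-invariance hypothesis of `map_orbMap_eq_subLaw` for the pair law. -/
theorem pairLaw_trans (a b : n) (hab : a ≠ b) (z : S n)
    (hz : ∀ c ∉ ({a, b} : Finset n), cplx (z : E n) c = 0) :
    ∃ t : Matrix.specialUnitaryGroup n ℂ, orbMap a t = z ∧
      (pairLaw a b hab).map (fun g => g * t) = pairLaw a b hab := by
  obtain ⟨A, hA⟩ := exists_pairHom_orbMap_eq a b hab z hz
  exact ⟨pairHom a b hab A, hA, pairLaw_map_mul_right a b hab A⟩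

/-- **The orbit law of the pair law is the sub-sphere law of the pair**:
law of (first column of the kick) `= subLaw {a, b}`. -/
theorem pairLaw_map_orbMap (a b : n) (hab : a ≠ b) :
    (pairLaw a b hab).map (orbMap a) = subLaw ({a, b} : Finset n) :=
  map_orbMap_eq_subLaw (Finset.insert_nonempty a {b}) (pairLaw a b hab) (ae_pairLaw_mem a b hab)
    (pairLaw_trans a b hab)

omit [Nonempty n] in
/-- **Orbit laws from any point of the sub-sphere agree with the orbit law from `e_i`** (right
invariance): for a law `μ` with the transitivity-with-invariance property and `u` on the sub-sphere,
law of `g • u` = law of `g • e_i`. -/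
theorem map_act_eq_map_orbMap {s : Finset n} {i : n} (μ : Measure (Matrix.specialUnitaryGroup n ℂ))
    (htrans : ∀ z : S n, (∀ a ∉ s, cplx (z : E n) a = 0) →
      ∃ t : Matrix.specialUnitaryGroup n ℂ, orbMap i t = z ∧ μ.map (fun g => g * t) = μ)
    (u : S n) (hu : ∀ a ∉ s, cplx (u : E n) a = 0) :
    μ.map (fun g => actSU g u) = μ.map (orbMap i) := by
  obtain ⟨t, rfl, ht⟩ := htrans u hu
  have h : (fun g => actSU g (orbMap i t)) = (orbMap i) ∘ (fun g => g * t) := by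
    funext g; simp [orbMap_mul]
  rw [h, ← Measure.map_map (measurable_orbMap i) (measurable_mul_const t), ht]

/-- **Uniqueness**: a finite measure on the sphere carried by the sub-sphere of `s` and invariant
under (almost) every element of a law `μ` as in `map_orbMap_eq_subLaw` is a multiple of `subLaw s`. -/
theorem eq_smul_subLaw_of_invariant {s : Finset n} (hs : s.Nonempty) {i : n}
    (μ : Measure (Matrix.specialUnitaryGroup n ℂ)) [IsProbabilityMeasure μ]
    (hμK : ∀ᵐ g ∂μ, g ∈ coordSubgroup s)
    (htrans : ∀ z : S n, (∀ a ∉ s, cplx (z : E n) a = 0) →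
      ∃ t : Matrix.specialUnitaryGroup n ℂ, orbMap i t = z ∧ μ.map (fun g => g * t) = μ)
    (m : Measure (S n)) [IsFiniteMeasure m] (hmK : ∀ᵐ z : S n ∂m, ∀ a ∉ s, cplx (z : E n) a = 0)
    (hminv : ∀ᵐ g ∂μ, m.map (actSU g) = m) :
    m = m univ • subLaw s := by
  ext A hA
  have hF : Measurable fun p : Matrix.specialUnitaryGroup n ℂ × S n =>
      A.indicator (1 : S n → ℝ≥0∞) (actSU p.1 p.2) :=
    (measurable_one.indicator hA).comp continuous_actSU.measurable
  have hinner : ∀ z : S n, (∀ a ∉ s, cplx (z : E n) a = 0) →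
      ∫⁻ g, A.indicator (1 : S n → ℝ≥0∞) (actSU g z) ∂μ = subLaw s A := by
    intro z hz
    rw [← map_orbMap_eq_subLaw hs μ hμK htrans, ← map_act_eq_map_orbMap μ htrans z hz,
      Measure.map_apply (measurable_actSU_left z) hA, ← lintegral_indicator_one ((measurable_actSU_left z) hA)]
    exact lintegral_congr fun g => rfl
  have houter : ∀ᵐ g ∂μ, ∫⁻ z, A.indicator (1 : S n → ℝ≥0∞) (actSU g z) ∂m = m A := by
    filter_upwards [hminv] with g hg
    change ∫⁻ z, ((fun z => actSU g z) ⁻¹' A).indicator 1 z ∂m = m A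
    rw [lintegral_indicator_one ((measurable_actSU_right g) hA),
      ← Measure.map_apply (measurable_actSU_right g) hA, hg]
  rw [Measure.smul_apply, smul_eq_mul]
  calc m A = ∫⁻ _g, m A ∂μ := by rw [lintegral_const, measure_univ, mul_one]
    _ = ∫⁻ g, ∫⁻ z, A.indicator (1 : S n → ℝ≥0∞) (actSU g z) ∂m ∂μ := (lintegral_congr_ae houter).symm
    _ = ∫⁻ z, ∫⁻ g, A.indicator (1 : S n → ℝ≥0∞) (actSU g z) ∂μ ∂m := lintegral_lintegral_swap hF.aemeasurable
    _ = ∫⁻ _z, subLaw s A ∂m := by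
        refine lintegral_congr_ae ?_
        filter_upwards [hmK] with z hz
        exact hinner z hz
    _ = m univ * subLaw s A := by rw [lintegral_const, mul_comm]

end PairLaw

/-! ## §2 Polar factorisation of the Gaussian pair block -/

section Polar

variable [Nonempty n]

/-- The radial law of the Gaussian block of `s`: the law of `‖projE s G‖`. -/
noncomputable def radLaw (s : Finset n) : Measure ℝ := (stdGaussian (E n)).map (fun x => ‖projE s x‖)

omit [Nonempty n] in
/-- It is a probability measure. -/
instance isProbabilityMeasure_radLaw (s : Finset n) : IsProbabilityMeasure (radLaw (n := n) s) :=
  Measure.isProbabilityMeasure_map (measurable_projE s).norm.aemeasurable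

omit [Nonempty n] in
/-- The norm of a projection is invariant under the coordinate subgroup. -/
theorem norm_projE_rotC {s : Finset n} {g : Matrix.specialUnitaryGroup n ℂ} (hg : g ∈ coordSubgroup s)
    (x : E n) :
    ‖projE s (rotC (g : Matrix n n ℂ) (Matrix.specialUnitaryGroup_le_unitaryGroup g.2) x)‖ = ‖projE s x‖ := by
  rw [← rotC_projE hg, LinearIsometryEquiv.norm_map]

/-- **Polar factorisation of the Gaussian pair block**: under the standard Gaussian, the direction
and the length of the `{a, b}`-block are independent, the direction having law `subLaw {a, b}`. -/
theorem stdGaussian_map_dir_norm_pair (a b : n) (hab : a ≠ b) :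
    (stdGaussian (E n)).map (fun x => (dirSphere (projE {a, b} x), ‖projE {a, b} x‖)) =
      (subLaw ({a, b} : Finset n)).prod (radLaw {a, b}) := by
  set Q : Finset n := {a, b} with hQ
  have hQne : Q.Nonempty := Finset.insert_nonempty a {b}
  have hpair : Measurable fun x : E n => (dirSphere (projE Q x), ‖projE Q x‖) :=
    (measurable_dirSphere_projE Q).prodMk (measurable_projE Q).norm
  symm
  refine Measure.prod_eq fun A T hA hT => ?_
  -- the measure `m_T(A) = γ{dir ∈ A, ‖·‖ ∈ T}` is invariant and carried by the sub-sphere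
  set m : Measure (S n) := ((stdGaussian (E n)).restrict {x | ‖projE Q x‖ ∈ T}).map
    (fun x => dirSphere (projE Q x)) with hm
  have hTset : MeasurableSet {x : E n | ‖projE Q x‖ ∈ T} := (measurable_projE Q).norm hT
  haveI : IsFiniteMeasure m := Measure.isFiniteMeasure_map _ _
  have hmA : ∀ {B : Set (S n)}, MeasurableSet B →
      m B = (stdGaussian (E n)).map (fun x => (dirSphere (projE Q x), ‖projE Q x‖)) (B ×ˢ T) := by
    intro B hB
    rw [hm, Measure.map_apply (measurable_dirSphere_projE Q) hB, Measure.restrict_apply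
      ((measurable_dirSphere_projE Q) hB), Measure.map_apply hpair (hB.prod hT)]
    congr 1
  -- carried by the sub-sphere
  have hmK : ∀ᵐ z : S n ∂m, ∀ c ∉ Q, cplx (z : E n) c = 0 := by
    rw [hm, ae_map_iff (measurable_dirSphere_projE Q).aemeasurable (measurableSet_supported Q)]
    refine ae_restrict_of_ae ?_
    filter_upwards [compl_mem_ae_iff.2 (stdGaussian_projE_eq_zero hQne)] with x hx c hc
    have hx' : projE Q x ≠ 0 := hx
    rw [dirSphere_coe hx', cplx_smul, Pi.smul_apply, cplx_projE_of_not_mem Q x hc, smul_zero]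
  -- invariant under the pair subgroup
  have hminv : ∀ᵐ g ∂(pairLaw a b hab), m.map (actSU g) = m := by
    filter_upwards [ae_pairLaw_mem a b hab] with g hg
    rw [hm, Measure.map_map (measurable_actSU_right g) (measurable_dirSphere_projE Q)]
    set ρ := rotC (g : Matrix n n ℂ) (Matrix.specialUnitaryGroup_le_unitaryGroup g.2) with hρ
    -- `γ.restrict {‖p_Q‖ ∈ T}` is `ρ`-invariant
    have hres : ((stdGaussian (E n)).restrict {x | ‖projE Q x‖ ∈ T}).map ρ =
        (stdGaussian (E n)).restrict {x | ‖projE Q x‖ ∈ T} := by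
      have hpre : ρ ⁻¹' {x | ‖projE Q x‖ ∈ T} = {x | ‖projE Q x‖ ∈ T} := by
        ext x
        change ‖projE Q (ρ x)‖ ∈ T ↔ ‖projE Q x‖ ∈ T
        rw [hρ, norm_projE_rotC hg]
      conv_lhs => rw [← hpre]
      rw [← Measure.restrict_map ρ.continuous.measurable hTset, hρ, stdGaussian_map_rotC]
    have hae : (actSU g ∘ fun x => dirSphere (projE Q x)) =ᵐ[(stdGaussian (E n)).restrict {x | ‖projE Q x‖ ∈ T}]
        ((fun x => dirSphere (projE Q x)) ∘ ρ) := by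
      refine ae_restrict_of_ae ?_
      filter_upwards [compl_mem_ae_iff.2 (stdGaussian_projE_eq_zero hQne)] with x hx
      have hx' : projE Q x ≠ 0 := hx
      change actSU g (dirSphere (projE Q x)) = dirSphere (projE Q (ρ x))
      rw [hρ, ← rotC_projE hg, dirSphere_rotC g hx']
    rw [Measure.map_congr hae, ← Measure.map_map (measurable_dirSphere_projE Q) ρ.continuous.measurable, hres]
  have huniq := eq_smul_subLaw_of_invariant hQne (pairLaw a b hab) (ae_pairLaw_mem a b hab)
    (pairLaw_trans a b hab) m hmK hminv
  rw [← hmA hA, huniq, Measure.smul_apply, smul_eq_mul, hmA MeasurableSet.univ, Measure.map_apply hpair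
    (MeasurableSet.univ.prod hT), radLaw, Measure.map_apply (measurable_projE Q).norm hT, mul_comm]
  congr 2
  ext x; simp

end Polar


end Summit.Ventures.LatticeQCDFlow.Exactness
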